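import Literature.AlgebraicGeometry.Motives.HighContactLineMultiplicity
import Literature.AlgebraicGeometry.Motives.HypersurfaceGysinDegree
import Literature.AlgebraicGeometry.Motives.LinearSubspaceSectionsRatEquiv
import Literature.AlgebraicGeometry.Motives.ChowZeroSupportedOnHyperplaneSection
import HarnessLib

/-!
# `CH₀` of a hypersurface of degree `≤ N` is supported on a hyperplane section (Roitman's strong lines)

Roitman's technique for `0`-cycles (A. A. Roitman, Mat. Zametki 28 (1980) 85–90; Hirschowitz–Iyer,
Contemp. Math. 522 (2010) = arXiv:0903.5018, §1.3: "The case of `0`-cycles has been handled by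
Roitman [Ro] … choosing a ruling by lines which are strong, in the sense that either they cut `Y` in
a single (multiple) point or they are inside `Y`", and §6, proof of Prop. 6.2 (i): "The variety of
`t`-fat points at `p` contained in `Y` is identified with a subvariety in the projectivized tangent
space of `Y` at `p` … The number of these equations is … at most … the dimension of this projective
space. Hence this variety is nonempty") on the tree's carriers, for a HYPERSURFACE
`i : X ≅ V₊(F) ⊆ ℙᴺ_K` of degree `2 ≤ e ≤ N` over an algebraically closed field (`Motives/Cycles`:
`primeCycle`, `cyclesOfDim`, `ratTrivial`, `IsRationallyEquivalent`):

* `Hypersurface.exists_sub_primeCycle_mem_ratTrivial_of_X_notMem` — **every closed point `x` of `X`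
  off the coordinate hyperplane `V₊(x_m)` is rationally equivalent ON `X` to a closed point of
  `X ∩ V₊(x_m)`.** Proof: in homogeneous coordinates `x = [p]` (`p_m ≠ 0`), the projective dimension
  theorem (`Literature.RingTheory.KrullDimension.exists_ne_zero_common_zero_of_isHomogeneous`:
  `e ≤ N` forms in `N + 1` variables) gives a STRONG direction `v₀` (`v₀,m = 0`, the coefficient
  forms `c₁, …, c_{e-1}` of `F(s p + y)` vanish at `v₀`: `F(s p + t v₀) = tᵉ F(v₀)`) and a direction
  `v₁` with `v₁,m = 0`, `F(v₁) = 0`, `c₂(v₁) = ⋯ = c_{e-1}(v₁) = 0` (`F(s p + t v₁) = s tᵉ⁻¹ c₁(v₁)`),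
  so that `[v₀], [v₁] ∈ V₊(x_m)` and `[v₁] ∈ X`. If a line `[p][v]` lies on `X` (`c₁(v₁) = 0`, or
  `F(v₀) = 0`), its two points `[p]`, `[v]` have the same class in `CH₀(X)`
  (`Hypersurface.ofPoint_eq_ofPoint_of_isLinearSubspacePoint`, `Motives/LinearSubspaceSectionsRatEquiv`).
  Otherwise `V₊(F) · [ℓ₀] = e [p]` and `V₊(F) · [ℓ₁] = (e-1) [p] + [v₁]`
  (`Motives/HighContactLineMultiplicity`), `[ℓ₀] = [ℓ₁]` in `CH₁(ℙᴺ)`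
  (`IsLinearSubspacePoint.ofPoint_eq_ofPoint_of_id`), and intersecting with `V₊(F)` passes to
  rational equivalence on `|V₊(F)| = X` (Fulton, Cor. 2.4.1: `Hypersurface.gysinCycle_formDivisor_mem_ratTrivial`,
  `Motives/HypersurfaceGysinDegree`), whence `[p] - [v₁] ∈ Rat₀(X)`.
* `Hypersurface.exists_forall_isRationallyEquivalent_primeCycle_of_degree_le` — **hence there is a
  proper Zariski-closed `W ⊊ X` (a coordinate hyperplane section) such that every closed point of `X`
  is rationally equivalent on `X` to a `0`-cycle supported on `W`** — the point-by-point form of the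
  `CH₀`-hypothesis of Voisin II, Prop. 10.26 (Bloch–Srinivas), extending
  `Motives/ChowZeroSupportedOnHyperplaneSection` (lines through every point, `Σ dⱼ + 1 ≤ N`) to the
  boundary degree `e = N`, e.g. the smooth QUINTIC FOURFOLD `V(5) ⊂ ℙ⁵` of the Hodge-conjecture item
  `HypersurfaceHodgeFourLowDegree` (route `HodgeConjecture/LimitExtension`), without rational curves /
  Mori's theorem.

Also: `ProjSpace.isLinearSubspacePoint_zero_of_base_eq_pt` (a point over a `K`-point is a `0`-plane
point), `ProjSpace.sub_primeCycle_linearSubspacePoint_mem_ratTrivial` (two lines of `ℙᴺ` are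
rationally equivalent, cycle form), `Hypersurface.sub_primeCycle_mem_ratTrivial_of_forall_eval_eq_zero`
(two points of a line of `X`). Everything is proved; no named facts, no definitions.

## References

* [HirschowitzIyer2010] A. Hirschowitz, J. N. N. Iyer, Hilbert schemes of fat r-planes and the
  triviality of Chow groups of complete intersections, Contemp. Math. 522 (2010) = arXiv:0903.5018,
  §1.3 and §6, proof of Prop. 6.2 (i) (text read).
* [Roitman1980] A. A. Roitman, Rational equivalence of zero-dimensional cycles, Mat. Zametki 28
  (1980) 85–90 (cite-only; [Ro] of Hirschowitz–Iyer).
* [Fulton1998] W. Fulton, Intersection Theory, 2nd ed. (1998), Cor. 2.4.1, Example 1.9.3,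
  Example 2.5.1.
* [VoisinHodgeII2003] C. Voisin, Hodge Theory and Complex Algebraic Geometry II (2003), Prop. 10.26
  and the remark following it (§10.2.3).
-/

noncomputable section

open CategoryTheory AlgebraicGeometry Order Topology TopologicalSpace MvPolynomial
open Literature.AlgebraicGeometry.Motives.Segre Literature.AlgebraicGeometry.Motives.RatFn

universe u

namespace Literature.AlgebraicGeometry.Motives

-- No `attribute [local instance] MvPolynomial.gradedAlgebra`: statements and proofs needing the
-- grading of `K[x₀, …, x_N]` supply it by an inline `letI`, which elaborates to the same terms as in
-- the files defining `formDivisor`, `linearSubspacePoint`, … (pattern of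
-- `Motives/ChowZeroSupportedOnHyperplaneSection`).

/-! ### `0`-plane points and pairs of lines in `ℙᴺ` -/

namespace ProjSpace

open ProjFamily ProjectiveSpace ProjectiveSpaceCells Literature.RingTheory.MvPolynomial

variable {K : Type u} [Field K] {N : ℕ}

/-- **A point of `Y ↪ ℙᴺ` lying over a `K`-point `[p]` is a `0`-plane point**: its closure is the
point itself (dimension `0`, `height_pt`) and is mapped onto `V₊(L₁, …, L_N)` for the `N` independent
linear forms cutting out `[p]` (`exists_linearForms_forall_mem_ideal_span_vanishing`; the zero locus
of `N` independent linear forms is a single point, `height_lt_of_mem_zeroLocus`).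
[cite: Hartshorne1977, I Ex. 2.11] -/
theorem isLinearSubspacePoint_zero_of_base_eq_pt [Infinite K] {Y : SchemeOver K}
    (j : Y ⟶ projectiveSpace N K) [IsClosedImmersion j.left] {p : Fin (N + 1) → K} (hp : p ≠ 0)
    {y : ↥Y.left} (hy : j.left.base y = (pointOfVec K p hp).pt) : IsLinearSubspacePoint 0 N j y := by
  classical
  letI := MvPolynomial.gradedAlgebra (σ := Fin (N + 1)) (R := K)
  have hy0 : height y = 0 := by
    rw [← height_base_eq_of_isClosedImmersion' j.left y, hy]
    exact height_pt _
  have hw : LinearIndependent K ![p] := by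
    rw [linearIndependent_unique_iff]
    exact hp
  obtain ⟨t, L, htu, hLlin, hLhom, hLvan, -⟩ := exists_linearForms_forall_mem_ideal_span_vanishing hw
  obtain rfl : t = N := by omega
  have hpt : (pointOfVec K p hp).pt ∈ ProjectiveSpectrum.zeroLocus
      (MvPolynomial.homogeneousSubmodule (Fin (t + 1)) K) (Set.range L) := by
    rintro _ ⟨l, rfl⟩
    exact mem_asHomogeneousIdeal_pt_pointOfVec hp one_pos (hLhom l)
      (hLvan l p (Submodule.subset_span ⟨0, rfl⟩))
  have key : ∀ z ∈ ProjectiveSpectrum.zeroLocus (MvPolynomial.homogeneousSubmodule (Fin (t + 1)) K)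
      (Set.range L), z = linearSubspacePoint L hLlin hLhom le_rfl := fun z hz => by
    by_contra hne
    have hlt := height_lt_of_mem_zeroLocus L hLlin hLhom le_rfl hz hne
    rw [Nat.sub_self, Nat.cast_zero] at hlt
    exact not_lt_zero hlt
  refine ⟨by rw [hy0, Nat.cast_zero], fun l => L (l.cast (Nat.sub_zero t)),
    hLlin.comp _ (Fin.cast_injective _), fun l => hLhom _, ?_⟩
  have hrange : Set.range (fun l : Fin (t - 0) => L (l.cast (Nat.sub_zero t))) = Set.range L :=
    Function.Surjective.range_comp (g := L) (finCongr (Nat.sub_zero t)).surjective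
  rw [hrange, closure_singleton_eq_of_height_eq_zero hy0, Set.image_singleton, hy]
  ext z
  simp only [Set.mem_singleton_iff]
  constructor
  · rintro rfl
    exact hpt
  · intro hz
    rw [key z hz, key _ hpt]

/-- **Two lines of `ℙᴺ_K` are rationally equivalent** (`K` algebraically closed), as cycles:
`[V₊(μ₀)] - [V₊(μ₁)] ∈ Rat₁(ℙᴺ)` for the generic points of the lines cut out by two families of
`N - 1` independent linear forms (`IsLinearSubspacePoint.ofPoint_eq_ofPoint_of_id`: both classes have
degree `1` in `CH₁(ℙᴺ) ≅ ℤ`, Fulton Example 1.9.3). [cite: Fulton1998, Example 1.9.3 (p. 23)] -/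
theorem sub_primeCycle_linearSubspacePoint_mem_ratTrivial [IsAlgClosed K] (hN : 1 ≤ N)
    {μ₀ μ₁ : Fin (N - 1) → MvPolynomial (Fin (N + 1)) K} (h₀li : LinearIndependent K μ₀)
    (h₀hom : ∀ l, (μ₀ l).IsHomogeneous 1) (h₁li : LinearIndependent K μ₁)
    (h₁hom : ∀ l, (μ₁ l).IsHomogeneous 1) :
    primeCycle (linearSubspacePoint μ₀ h₀li h₀hom (Nat.sub_le N 1)) -
        primeCycle (linearSubspacePoint μ₁ h₁li h₁hom (Nat.sub_le N 1)) ∈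
      ratTrivial (projectiveSpace N K).left 1 := by
  have hw₀ := isLinearSubspacePoint_one_linearSubspacePoint hN h₀li h₀hom
  have hw₁ := isLinearSubspacePoint_one_linearSubspacePoint hN h₁li h₁hom
  exact ChowGroup.mk_eq_mk_iff.mp (hw₀.ofPoint_eq_ofPoint_of_id hw₁)

/-- `p` and `v` are independent when `v ≠ 0`, `v_m = 0 ≠ p_m`. [folklore] -/
theorem linearIndependent_pair_of_apply_eq_zero {p v : Fin (N + 1) → K} {m : Fin (N + 1)}
    (hpm : p m ≠ 0) (hv : v ≠ 0) (hvm : v m = 0) : LinearIndependent K ![p, v] := by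
  rw [LinearIndependent.pair_iff]
  intro a b hab
  have hm := congr_fun hab m
  simp only [Pi.add_apply, Pi.smul_apply, smul_eq_mul, hvm, mul_zero, add_zero, Pi.zero_apply,
    mul_eq_zero] at hm
  have ha : a = 0 := hm.resolve_right hpm
  subst ha
  rw [zero_smul, zero_add] at hab
  exact ⟨rfl, (smul_eq_zero.mp hab).resolve_right hv⟩

end ProjSpace

/-! ### Roitman's strong lines on a hypersurface -/

namespace Hypersurface

open ProjSpace ProjFamily ProjectiveSpace Literature.RingTheory.MvPolynomial

variable {K : Type u} [Field K] [IsAlgClosed K] {d e : ℕ} {X : SchemeOver K} [IsIntegral X.left]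
  [LocallyOfFiniteType X.hom] (i : X ⟶ projectiveSpace (d + 1) K) [IsClosedImmersion i.left]
  {F : MvPolynomial (Fin (d + 1 + 1)) K} (hF : F ∈ grading (Fin (d + 1 + 1)) K e) (hprime : Prime F)
  (hrange : letI := MvPolynomial.gradedAlgebra (σ := Fin (d + 1 + 1)) (R := K)
    Set.range i.left.base =
      ProjectiveSpectrum.zeroLocus (MvPolynomial.homogeneousSubmodule (Fin (d + 1 + 1)) K) {F})

include hF hprime hrange in
/-- **Two points of a line of the hypersurface are rationally equivalent on it.** If `F` (of degree
`e ≥ 2`) vanishes identically on `span(p, v)` (`p, v` independent), and `x, x₁ ∈ X` lie over the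
`K`-points `[p], [v]`, then `[x] - [x₁] ∈ Rat₀(X)`: the line `V₊(μ) = [p][v]` lies on `i(X) = V₊(F)`,
is the image of a line point `z` of `X`, and `x, x₁` are `0`-planes of it
(`Hypersurface.ofPoint_eq_ofPoint_of_isLinearSubspacePoint`; Fulton Example 2.5.1 with Cor. 2.4.2).
[cite: HirschowitzIyer2010, §1.3 ("or they are inside Y")] [cite: Fulton1998, Example 2.5.1 and Cor. 2.4.2] -/
theorem sub_primeCycle_mem_ratTrivial_of_forall_eval_eq_zero (he2 : 2 ≤ e)
    {p v : Fin (d + 1 + 1) → K} (hpv : LinearIndependent K ![p, v])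
    (hvan : ∀ s t : K, eval (s • p + t • v) F = 0) {x x₁ : ↥X.left}
    (hx : i.left.base x = (pointOfVec K p (by simpa using hpv.ne_zero 0)).pt)
    (hx₁ : i.left.base x₁ = (pointOfVec K v (by simpa using hpv.ne_zero 1)).pt) :
    primeCycle x - primeCycle x₁ ∈ ratTrivial X.left 0 := by
  classical
  letI := MvPolynomial.gradedAlgebra (σ := Fin (d + 1 + 1)) (R := K)
  have hp0 : p ≠ 0 := by simpa using hpv.ne_zero 0
  have hv0 : v ≠ 0 := by simpa using hpv.ne_zero 1
  have hN : 1 ≤ d + 1 := by omega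
  obtain ⟨μ, hμli, hμhom, hμv, hμideal⟩ := exists_lineForms ![p, v] hpv hN
  have hFμ : F ∈ Ideal.span (Set.range μ) := hμideal F fun s t => by simpa using hvan s t
  set w := linearSubspacePoint μ hμli hμhom (Nat.sub_le (d + 1) 1) with hw
  -- the line lies on `i(X) = V₊(F)`: it is the image of a line point `z` of `X`
  have hwF : w ∈ ProjectiveSpectrum.zeroLocus
      (MvPolynomial.homogeneousSubmodule (Fin (d + 1 + 1)) K) {F} := by
    refine Set.singleton_subset_iff.2 ?_
    change F ∈ (ProjectiveSpectrum.asHomogeneousIdeal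
      (𝒜 := MvPolynomial.homogeneousSubmodule (Fin (d + 1 + 1)) K) w).toIdeal
    rw [hw, toIdeal_linearSubspacePoint]
    exact hFμ
  obtain ⟨z, hz⟩ : w ∈ Set.range i.left.base := by rw [hrange]; exact hwF
  have hzlin : IsLinearSubspacePoint (0 + 1) (d + 1) i z := by
    have h := isLinearSubspacePoint_of_toIdeal_base_eq_span i μ hμli hμhom (Nat.sub_le (d + 1) 1)
      (z := z) (by rw [hz, hw, toIdeal_linearSubspacePoint])
    rwa [show d + 1 - (d + 1 - 1) = 0 + 1 by omega] at h
  -- `x`, `x₁` are `0`-planes of that line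
  have hxpt := isLinearSubspacePoint_zero_of_base_eq_pt i hp0 hx
  have hx₁pt := isLinearSubspacePoint_zero_of_base_eq_pt i hv0 hx₁
  have hcl : closure {i.left.base z} = ProjectiveSpectrum.zeroLocus
      (MvPolynomial.homogeneousSubmodule (Fin (d + 1 + 1)) K) (Set.range μ) := by
    rw [hz, hw]
    exact closure_linearSubspacePoint μ hμli hμhom _
  have himg : ⇑i.left.base '' closure {z} = closure {i.left.base z} := by
    rw [← i.left.isClosedEmbedding.closure_image_eq, Set.image_singleton]
  have hspec : ∀ {y : ↥X.left} {q : Fin (d + 1 + 1) → K} (hq : q ≠ 0),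
      i.left.base y = (pointOfVec K q hq).pt → (∀ l, eval q (μ l) = 0) → z ⤳ y := by
    intro y q hq hy hqμ
    have hmem : i.left.base y ∈ closure {i.left.base z} := by
      rw [hcl, hy]
      rintro _ ⟨l, rfl⟩
      exact mem_asHomogeneousIdeal_pt_pointOfVec hq one_pos (hμhom l) (hqμ l)
    rw [← himg] at hmem
    obtain ⟨y', hy', hyy'⟩ := hmem
    rw [i.left.isClosedEmbedding.injective hyy'] at hy'
    exact specializes_iff_mem_closure.2 hy'
  have hzx : z ⤳ x := hspec hp0 hx fun l => by simpa using hμv l 0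
  have hzx₁ : z ⤳ x₁ := hspec hv0 hx₁ fun l => by simpa using hμv l 1
  exact ChowGroup.mk_eq_mk_iff.mp
    (ofPoint_eq_ofPoint_of_isLinearSubspacePoint i hF hprime hrange he2 hzlin hxpt hx₁pt hzx hzx₁)

include hF hprime hrange in
/-- **Roitman: a closed point of a hypersurface of degree `2 ≤ e ≤ N` is rationally equivalent ON
`X` to a closed point of a given coordinate hyperplane section.** For `i : X ≅ V₊(F) ⊆ ℙᴺ_K`
(`N = d + 1`, `K` algebraically closed, `F` prime of degree `e`, `2 ≤ e ≤ N`) and a closed point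
`x` with `x_m(x) ≠ 0`, there is a closed point `x₁ ∈ X ∩ V₊(x_m)` with `[x] - [x₁] ∈ Rat₀(X)`.
With `x = [p]`: the projective dimension theorem gives a strong direction `v₀` (`v₀,m = 0`,
`F(s p + t v₀) = tᵉ F(v₀)`; `e` forms `x_m, c₁, …, c_{e-1}` in `N + 1 > e` variables) and a
direction `v₁` (`v₁,m = 0`, `F(v₁) = 0`, `F(s p + t v₁) = s tᵉ⁻¹ c₁(v₁)`; forms
`x_m, F, c₂, …, c_{e-1}`). If `[p][v₁]` or `[p][v₀]` lies on `X`, conclude by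
`sub_primeCycle_mem_ratTrivial_of_forall_eval_eq_zero`. Otherwise `V₊(F) · [ℓ₀] = e [p]`,
`V₊(F) · [ℓ₁] = (e-1) [p] + [v₁]`, `[ℓ₀] - [ℓ₁] ∈ Rat₁(ℙᴺ)`, and Fulton's Cor. 2.4.1
(`gysinCycle_formDivisor_mem_ratTrivial`) gives `[p] - [v₁] ∈ Rat₀(X)`.
[cite: HirschowitzIyer2010, §1.3 and proof of Prop. 6.2 (i)] [cite: Roitman1980]
[cite: Fulton1998, Cor. 2.4.1 (p. 38) and Example 1.9.3] -/
theorem exists_sub_primeCycle_mem_ratTrivial_of_X_notMem (he2 : 2 ≤ e) (heN : e ≤ d + 1)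
    (m : Fin (d + 1 + 1)) {x : ↥X.left} (hx0 : height x = 0)
    (hxm : letI := MvPolynomial.gradedAlgebra (σ := Fin (d + 1 + 1)) (R := K)
      (MvPolynomial.X m : MvPolynomial (Fin (d + 1 + 1)) K) ∉
        ProjectiveSpectrum.asHomogeneousIdeal
          (𝒜 := MvPolynomial.homogeneousSubmodule (Fin (d + 1 + 1)) K) (i.left.base x)) :
    letI := MvPolynomial.gradedAlgebra (σ := Fin (d + 1 + 1)) (R := K)
    ∃ x₁ : ↥X.left, height x₁ = 0 ∧
      (MvPolynomial.X m : MvPolynomial (Fin (d + 1 + 1)) K) ∈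
        ProjectiveSpectrum.asHomogeneousIdeal
          (𝒜 := MvPolynomial.homogeneousSubmodule (Fin (d + 1 + 1)) K) (i.left.base x₁) ∧
      primeCycle x - primeCycle x₁ ∈ ratTrivial X.left 0 := by
  classical
  letI := MvPolynomial.gradedAlgebra (σ := Fin (d + 1 + 1)) (R := K)
  have he : 0 < e := by omega
  have hN : 1 ≤ d + 1 := by omega
  have hFhom : F.IsHomogeneous e := (mem_homogeneousSubmodule e F).1 hF
  -- homogeneous coordinates `p` of the closed point `x`
  have hxcl : IsClosed ({x} : Set ↥X.left) := isClosed_singleton_of_height_eq_zero hx0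
  obtain ⟨Pt, hPx⟩ := EsnaultLevineViehweg.exists_algPoints_pt_eq (X := X) hxcl
  obtain ⟨p, hp, hQ⟩ := ProjectiveSpace.exists_eq_pointOfVec (AlgPoints.map i Pt)
  have hix : i.left.base x = (pointOfVec K p hp).pt := by rw [← hPx, ← AlgPoints.pt_map, hQ]
  have hFp : eval p F = 0 := by
    have hmem : i.left.base x ∈ ProjectiveSpectrum.zeroLocus
        (MvPolynomial.homogeneousSubmodule (Fin (d + 1 + 1)) K) {F} := by
      rw [← hrange]; exact ⟨x, rfl⟩
    rw [hix] at hmem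
    have h := (pt_pointOfVec_mem_zeroLocus_iff p hp he hF).1 hmem
    rwa [MvPolynomial.aeval_eq_eval] at h
  have hpm : p m ≠ 0 := by
    intro h0
    apply hxm
    rw [hix]
    exact mem_asHomogeneousIdeal_pt_pointOfVec hp one_pos (isHomogeneous_X K m) (by rwa [eval_X])
  -- a closed point of `X ∩ V₊(x_m)` over `[v]` for every `v ≠ 0` with `v_m = 0`, `F(v) = 0`
  have hpoint : ∀ {v : Fin (d + 1 + 1) → K} (hv : v ≠ 0), v m = 0 → eval v F = 0 →
      ∃ x₁ : ↥X.left, height x₁ = 0 ∧ i.left.base x₁ = (pointOfVec K v hv).pt ∧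
        (MvPolynomial.X m : MvPolynomial (Fin (d + 1 + 1)) K) ∈
          ProjectiveSpectrum.asHomogeneousIdeal
            (𝒜 := MvPolynomial.homogeneousSubmodule (Fin (d + 1 + 1)) K) (i.left.base x₁) := by
    intro v hv hvm hvF
    have hmem : (pointOfVec K v hv).pt ∈ Set.range i.left.base := by
      rw [hrange]
      refine (pt_pointOfVec_mem_zeroLocus_iff v hv he hF).2 ?_
      rwa [MvPolynomial.aeval_eq_eval]
    obtain ⟨x₁, hx₁⟩ := hmem
    refine ⟨x₁, ?_, hx₁, ?_⟩
    · rw [← height_base_eq_of_isClosedImmersion' i.left x₁, hx₁]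
      exact height_pt _
    · rw [hx₁]
      exact mem_asHomogeneousIdeal_pt_pointOfVec hv one_pos (isHomogeneous_X K m) (by rwa [eval_X])
  -- the coefficient forms `c_j` of `F(s p + y)` (degree `e - j`)
  set c : ℕ → MvPolynomial (Fin (d + 1 + 1)) K := fun j => coeff (Finsupp.single 0 j) (linePoly p F)
    with hc
  have hchom : ∀ j, (c j).IsHomogeneous (e - j) := fun j => by
    have h := (isBihom_linePoly p hFhom (Finsupp.single 0 j)).1
    rwa [Finsupp.degree_single] at h
  -- the STRONG direction `v₀`: `x_m, c₁, …, c_{e-1}` have a common non-trivial zero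
  obtain ⟨v₀, hv₀0, hv₀⟩ : ∃ v₀ : Fin (d + 1 + 1) → K, v₀ ≠ 0 ∧
      ∀ a : Option (Fin (e - 1)), eval v₀ (a.elim (MvPolynomial.X m) fun j => c (j + 1)) = 0 := by
    refine Literature.RingTheory.KrullDimension.exists_ne_zero_common_zero_of_isHomogeneous
      (fun a : Option (Fin (e - 1)) => a.elim (MvPolynomial.X m) fun j => c (j + 1))
      (fun a => a.elim 1 fun j => e - (j + 1)) (fun a => ?_) (fun a => ?_) ?_
    · cases a with
      | none => exact isHomogeneous_X K m
      | some j => exact hchom _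
    · cases a with
      | none => exact one_pos
      | some j => have := j.2; change 0 < e - (j + 1); omega
    · rw [Fintype.card_option, Fintype.card_fin]; omega
  have hv₀m : v₀ m = 0 := by simpa using hv₀ none
  have hv₀c : ∀ j, 1 ≤ j → j < e → eval v₀ (coeff (Finsupp.single 0 j) (linePoly p F)) = 0 := by
    intro j hj hje
    obtain ⟨j', rfl⟩ : ∃ j', j = j' + 1 := ⟨j - 1, by omega⟩
    exact hv₀ (some ⟨j', by omega⟩)
  have hosc₀ : ∀ s t : K, eval (s • p + t • v₀) F = t ^ e * eval v₀ F :=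
    eval_add_smul_eq_pow_mul_of_forall_coeff hFhom hFp hv₀c
  have hpv₀ : LinearIndependent K ![p, v₀] := linearIndependent_pair_of_apply_eq_zero hpm hv₀0 hv₀m
  -- the direction `v₁`: `x_m, F, c₂, …, c_{e-1}` have a common non-trivial zero
  obtain ⟨v₁, hv₁0, hv₁⟩ : ∃ v₁ : Fin (d + 1 + 1) → K, v₁ ≠ 0 ∧
      ∀ a : Option (Option (Fin (e - 2))),
        eval v₁ (a.elim (MvPolynomial.X m) fun b => b.elim F fun j => c (j + 2)) = 0 := by
    refine Literature.RingTheory.KrullDimension.exists_ne_zero_common_zero_of_isHomogeneous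
      (fun a : Option (Option (Fin (e - 2))) =>
        a.elim (MvPolynomial.X m) fun b => b.elim F fun j => c (j + 2))
      (fun a => a.elim 1 fun b => b.elim e fun j => e - (j + 2)) (fun a => ?_) (fun a => ?_) ?_
    · rcases a with _ | _ | j
      · exact isHomogeneous_X K m
      · exact hFhom
      · exact hchom _
    · rcases a with _ | _ | j
      · exact one_pos
      · exact he
      · have := j.2; change 0 < e - (j + 2); omega
    · rw [Fintype.card_option, Fintype.card_option, Fintype.card_fin]; omega
  have hv₁m : v₁ m = 0 := by simpa using hv₁ none
  have hv₁F : eval v₁ F = 0 := hv₁ (some none)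
  have hv₁c : ∀ j, 2 ≤ j → j < e → eval v₁ (coeff (Finsupp.single 0 j) (linePoly p F)) = 0 := by
    intro j hj hje
    obtain ⟨j', rfl⟩ : ∃ j', j = j' + 2 := ⟨j - 2, by omega⟩
    exact hv₁ (some (some ⟨j', by omega⟩))
  have hosc₁ : ∀ s t : K, eval (s • p + t • v₁) F =
      s * t ^ (e - 1) * eval v₁ (coeff (Finsupp.single 0 1) (linePoly p F)) :=
    eval_add_smul_eq_mul_of_forall_coeff hFhom hFp hv₁F hv₁c
  have hpv₁ : LinearIndependent K ![p, v₁] := linearIndependent_pair_of_apply_eq_zero hpm hv₁0 hv₁m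
  obtain ⟨x₁, hx₁0, hix₁, hx₁m⟩ := hpoint hv₁0 hv₁m hv₁F
  -- Case 1: the line `[p][v₁]` lies on `X`
  by_cases ha : eval v₁ (coeff (Finsupp.single 0 1) (linePoly p F)) = 0
  · refine ⟨x₁, hx₁0, hx₁m, ?_⟩
    refine sub_primeCycle_mem_ratTrivial_of_forall_eval_eq_zero i hF hprime hrange he2 hpv₁
      (fun s t => ?_) hix hix₁
    rw [hosc₁ s t, ha, mul_zero]
  -- Case 2: the strong line `[p][v₀]` lies on `X`
  by_cases hF₀ : eval v₀ F = 0
  · obtain ⟨x₀, hx₀0, hix₀, hx₀m⟩ := hpoint hv₀0 hv₀m hF₀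
    refine ⟨x₀, hx₀0, hx₀m, ?_⟩
    refine sub_primeCycle_mem_ratTrivial_of_forall_eval_eq_zero i hF hprime hrange he2 hpv₀
      (fun s t => ?_) hix hix₀
    rw [hosc₀ s t, hF₀, mul_zero]
  -- Case 3: `V₊(F) · [ℓ₀] = e [p]`, `V₊(F) · [ℓ₁] = (e-1) [p] + [v₁]`, `[ℓ₀] ∼ [ℓ₁]`, Cor. 2.4.1
  refine ⟨x₁, hx₁0, hx₁m, ?_⟩
  obtain ⟨μ₀, h₀li, h₀hom, h₀v, h₀ideal⟩ := exists_lineForms ![p, v₀] hpv₀ hN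
  obtain ⟨μ₁, h₁li, h₁hom, h₁v, h₁ideal⟩ := exists_lineForms ![p, v₁] hpv₁ hN
  have hD₀ : (formDivisor F hF hprime.ne_zero).primeInter (X := projectiveSpace (d + 1) K)
      (linearSubspacePoint μ₀ h₀li h₀hom (Nat.sub_le (d + 1) 1)) =
        e • primeCycle (pointOfVec K p hp).pt :=
    primeInter_formDivisor_line_eq_degree_smul hN hpv₀ he hF hprime.ne_zero hosc₀ hF₀ h₀li h₀hom
      (fun l => by simpa using h₀v l 0) (fun l => by simpa using h₀v l 1)
      fun G hG => h₀ideal G fun s t => by simpa using hG s t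
  have hD₁ : (formDivisor F hF hprime.ne_zero).primeInter (X := projectiveSpace (d + 1) K)
      (linearSubspacePoint μ₁ h₁li h₁hom (Nat.sub_le (d + 1) 1)) =
        (e - 1) • primeCycle (pointOfVec K p hp).pt + primeCycle (pointOfVec K v₁ hv₁0).pt :=
    primeInter_formDivisor_line_eq_pred_smul_add hN hpv₁ he hF hprime.ne_zero ha hosc₁ h₁li h₁hom
      (fun l => by simpa using h₁v l 0) (fun l => by simpa using h₁v l 1)
      fun G hG => h₁ideal G fun s t => by simpa using hG s t
  have hrat := sub_primeCycle_linearSubspacePoint_mem_ratTrivial hN h₀li h₀hom h₁li h₁hom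
  have hg := gysinCycle_formDivisor_mem_ratTrivial i hF hprime hrange (m := 0) hrat
  -- `V₊(F) · ([ℓ₀] - [ℓ₁]) = [p] - [v₁] = i_* ([x] - [x₁])`
  have hinter : (formDivisor F hF hprime.ne_zero).interCycle
      (primeCycle (linearSubspacePoint μ₀ h₀li h₀hom (Nat.sub_le (d + 1) 1)) -
      primeCycle (linearSubspacePoint μ₁ h₁li h₁hom (Nat.sub_le (d + 1) 1))) =
        AlgebraicCycle.map i.left height height (primeCycle x - primeCycle x₁) := by
    rw [CartierDivisor.interCycle_sub, CartierDivisor.interCycle_primeCycle,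
      CartierDivisor.interCycle_primeCycle, hD₀, hD₁, algebraicCycleMap_sub',
      algebraicCycleMap_primeCycle, algebraicCycleMap_primeCycle, hix, hix₁]
    obtain ⟨e', rfl⟩ : ∃ e', e = e' + 1 := ⟨e - 1, by omega⟩
    rw [Nat.add_sub_cancel, succ_nsmul]
    abel
  have hgys : CartierDivisor.gysinCycle (X := projectiveSpace (d + 1) K) i.left
      (formDivisor F hF hprime.ne_zero) (primeCycle (linearSubspacePoint μ₀ h₀li h₀hom (Nat.sub_le (d + 1) 1)) -
        primeCycle (linearSubspacePoint μ₁ h₁li h₁hom (Nat.sub_le (d + 1) 1))) =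
      primeCycle x - primeCycle x₁ := by
    rw [CartierDivisor.gysinCycle, hinter, cycleRestrictClosed_map]
  rw [hgys] at hg
  exact hg

include hF hprime hrange in
/-- **`CH₀` of a hypersurface of degree `≤ N` is supported on a hyperplane section, point by point**
(the `CH₀`-hypothesis of Voisin II, Prop. 10.26 = Bloch–Srinivas, for hypersurfaces of degree
`e ≤ N`; Roitman's theorem that all points are rationally equivalent, in the form needed there).
For `i : X ≅ V₊(F) ⊆ ℙᴺ_K` (`K` algebraically closed, `F` prime of degree `2 ≤ e ≤ N = d + 1`) there
is a proper Zariski-closed `W ⊊ X` — the coordinate hyperplane section `X ∩ V₊(x_m)` through none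
of the generic point — such that every closed point `x` of `X` is rationally equivalent ON `X` to a
`0`-cycle supported on `W` (namely to a closed point of `W`,
`exists_sub_primeCycle_mem_ratTrivial_of_X_notMem`). For the smooth quintic fourfold `V(5) ⊂ ℙ⁵_ℂ`
this is the input of the Bloch–Srinivas route to the Hodge conjecture (Conte–Murre 1978) without
rational curves. [cite: HirschowitzIyer2010, §1.3 and proof of Prop. 6.2 (i)] [cite: Roitman1980]
[cite: VoisinHodgeII2003, Prop. 10.26 and the remark following it (§10.2.3)] -/
theorem exists_forall_isRationallyEquivalent_primeCycle_of_degree_le (he2 : 2 ≤ e) (heN : e ≤ d + 1) :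
    ∃ W : Set ↥X.left, IsClosed W ∧ W ≠ Set.univ ∧
      ∀ x : ↥X.left, height x = 0 →
        ∃ c' ∈ cyclesOfDim X.left 0, (∀ z, c' z ≠ 0 → z ∈ W) ∧
          IsRationallyEquivalent (primeCycle x) c' 0 := by
  classical
  letI := MvPolynomial.gradedAlgebra (σ := Fin (d + 1 + 1)) (R := K)
  -- a coordinate hyperplane `V₊(x_m) ⊅ i(X)` and the hyperplane section `W = X ∩ V₊(x_m)`
  obtain ⟨m, hm⟩ := ProjSpace.exists_X_notMem (d := d + 1) (K := K) (i.left (genericPoint ↥X.left))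
  set W : Set ↥X.left := {x | (MvPolynomial.X m : MvPolynomial (Fin (d + 1 + 1)) K) ∈
    ProjectiveSpectrum.asHomogeneousIdeal (𝒜 := MvPolynomial.homogeneousSubmodule (Fin (d + 1 + 1)) K)
      (i.left.base x)} with hW_def
  have hWpre : W = i.left.base ⁻¹'
      ProjectiveSpectrum.zeroLocus (MvPolynomial.homogeneousSubmodule (Fin (d + 1 + 1)) K)
        {MvPolynomial.X m} := by
    ext x
    change (MvPolynomial.X m : MvPolynomial (Fin (d + 1 + 1)) K) ∈
        ProjectiveSpectrum.asHomogeneousIdeal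
          (𝒜 := MvPolynomial.homogeneousSubmodule (Fin (d + 1 + 1)) K) (i.left.base x) ↔
      ({MvPolynomial.X m} : Set (MvPolynomial (Fin (d + 1 + 1)) K)) ⊆
        (ProjectiveSpectrum.asHomogeneousIdeal
          (𝒜 := MvPolynomial.homogeneousSubmodule (Fin (d + 1 + 1)) K) (i.left.base x) :
            Set (MvPolynomial (Fin (d + 1 + 1)) K))
    exact Set.singleton_subset_iff.symm
  refine ⟨W, ?_, ?_, fun x hx0 => ?_⟩
  · rw [hWpre]
    exact (ProjectiveSpectrum.isClosed_zeroLocus _ _).preimage i.left.continuous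
  · intro hWu
    have h : genericPoint ↥X.left ∈ W := hWu ▸ Set.mem_univ _
    exact hm h
  by_cases hxW : x ∈ W
  · -- `x` already lies on the hyperplane section
    refine ⟨primeCycle x, primeCycle_mem_cyclesOfDim (by exact_mod_cast hx0), fun z' hz' => ?_,
      IsRationallyEquivalent.refl _⟩
    by_cases h : z' = x
    · rw [h]; exact hxW
    · exact absurd (primeCycle_apply_of_ne h) hz'
  · obtain ⟨x₁, hx₁0, hx₁m, hrat⟩ :=
      exists_sub_primeCycle_mem_ratTrivial_of_X_notMem i hF hprime hrange he2 heN m hx0 hxW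
    refine ⟨primeCycle x₁, primeCycle_mem_cyclesOfDim (by exact_mod_cast hx₁0), fun z' hz' => ?_, hrat⟩
    by_cases h : z' = x₁
    · rw [h]; exact hx₁m
    · exact absurd (primeCycle_apply_of_ne h) hz'

end Hypersurface

end Literature.AlgebraicGeometry.Motives

end
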